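import Mathlib.Analysis.Calculus.MeanValue
import Literature.Analysis.FluidPDE.KNSSRegularityWindow
import HarnessLib

/-!
# KNSS 2009, §4 on a window, consequence: the uniform space–time Lipschitz bound for bounded
# weak solutions obeying `|u| ≤ C/|x'|`

Analysis/FluidPDE support file (proved) on the decomposition path of the named fact
`Literature.Analysis.FluidPDE.KNSS2009_regularity_bound_C_over_r` (`KNSSTypeII.lean`;
Koch–Nadirashvili–Seregin–Šverák, Acta Math. 203 (2009) = arXiv:0709.3599, **Theorem 6.1**).
The printed proof (p. 12) extracts from the rescalings `v^{(k)}` of (6.2) a locally uniformly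
convergent subsequence ("by Lemma 6.1", i.e. by the uniform regularity of §4) and evaluates the
limit at the final time (`|v(0,0)| = 1`). The regularity input it needs is a **uniform
space–time Lipschitz bound, up to the final time, for bounded weak solutions on a unit window
obeying the scale-invariant bound (6.4)** `|x'| |u| ≤ C`. This file PROVES that bound from the
accepted named fact `KNSS2009_regularity_boundedWeak_window` (§4, (4.10)–(4.11) with the
decomposition `u = U + b(t)` of Lemma 3.1, `KNSSRegularityWindow.lean`):

* `KNSS2009_regularity_boundedWeak_window.lipschitz_of_cylRadius_bound`: for every `M` there is
  `K` such that every bounded weak solution `u` (`ν = 1`) on `ℝ³ × (0, 1)`, continuous on the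
  open slab, with `‖u‖ ≤ M` and `|x'| ‖u‖ ≤ C` (any `C`), satisfies
  `‖u(t, x) − u(s, y)‖ ≤ K (|t − s| + ‖x − y‖)` for `s, t ∈ [1/2, 1)`, `x, y ∈ ℝ³`.

Derivation (the one of the review of p18191): the window fact gives `u(t, ·) = U(t, ·) + b(t)`
a.e. in `x` for a.e. `t`, with `‖∇U‖ ≤ C(1, δ)` and `‖U(t, x) − U(s, x)‖ ≤ L(0, δ)|t − s|` on
`(δ, 1)`; (a) at such *good* times both sides are continuous in `x`, so `u(t, ·) = U(t, ·) + b(t)`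
everywhere; (b) at good `s, t`: `‖b(t) − b(s)‖ ≤ ‖u(t, x)‖ + ‖u(s, x)‖ + ‖U(t, x) − U(s, x)‖ ≤
2C/|x'| + L|t − s|`, and `|x'| → ∞` gives `‖b(t) − b(s)‖ ≤ L|t − s|` — this is where the decay
(6.4) of `u` enters, killing the time oscillation of the parasitic part `b` (KNSS, proof of
Thm. 6.1, last paragraph: under (6.4) "`b` must vanish"); (c) the mean value inequality for
`U(t, ·)` and the triangle inequality give the bound at good times in `(1/4, 1)` with
`K = |C(1, 1/4)| + 2|L(0, 1/4)|`, depending on `M` only (as printed); (d) good times are conull,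
hence dense, and `u` is continuous on the open slab, so the bound extends to all
`s, t ∈ [1/2, 1) ⊂ (1/4, 1)`.

## References

* G. Koch, N. Nadirashvili, G. Seregin, V. Šverák, *Liouville theorems for the Navier–Stokes
  equations and applications*, Acta Math. 203 (2009) = arXiv:0709.3599v1: §3 Lemma 3.1 (p. 7);
  §4 closing paragraph, (4.10)–(4.11) (p. 8); §6 Lemma 6.1, Theorem 6.1 with Remark 6.2 (p. 11)
  and its proof (p. 12). [KochNadirashviliSereginSverak2009]
-/

noncomputable section

open MeasureTheory Set Function Filter Topology TopologicalSpace

namespace Literature.Analysis.FluidPDE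

/-- The order-zero case of the time-Lipschitz clause of the window fact is a bound on
`‖U(t, x) − U(s, x)‖`: `‖D⁰f(x) − D⁰g(x)‖ = ‖f(x) − g(x)‖`. [folklore] -/
theorem norm_iteratedFDeriv_zero_sub {E F : Type*} [NormedAddCommGroup E] [NormedSpace ℝ E]
    [NormedAddCommGroup F] [NormedSpace ℝ F] (f g : E → F) (x : E) :
    ‖iteratedFDeriv ℝ 0 f x - iteratedFDeriv ℝ 0 g x‖ = ‖f x - g x‖ := by
  rw [iteratedFDeriv_zero_eq_comp, iteratedFDeriv_zero_eq_comp, comp_apply, comp_apply,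
    ← map_sub, LinearIsometryEquiv.norm_map]

/-- The point `(R, 0, 0)` has cylindrical radius `|R|`. [folklore] -/
theorem cylRadius_single_zero (R : ℝ) : cylRadius (EuclideanSpace.single 0 R) = |R| := by
  rw [cylRadius]
  simp [Real.sqrt_sq_eq_abs]

/-- **Uniform space–time Lipschitz bound for bounded weak solutions with `|x'| |u| ≤ C`, from
KNSS 2009, §4 on a window** (Acta Math. 203 (2009) = arXiv:0709.3599v1: (4.10)–(4.11) p. 8 with
the decomposition `u = U + b` of Lemma 3.1 p. 7, vendored as
`KNSS2009_regularity_boundedWeak_window`; the decay (6.4) of Thm. 6.1 p. 11 controls the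
parasitic part `b`, cf. the last paragraph of the proof of Thm. 6.1, p. 12). For every `M` there
is `K ≥ 0` such that: for every `C` and every bounded weak solution `u` of Navier–Stokes
(`ν = 1`) on `ℝ³ × (0, 1)` (`IsBoundedWeakNSSolutionOn (Ioo 0 1)`), continuous on the open slab
`(0, 1) × ℝ³`, with `‖u(t, x)‖ ≤ M` and `|x'| ‖u(t, x)‖ ≤ C` there,
`‖u(t, x) − u(s, y)‖ ≤ K (|t − s| + ‖x − y‖)` for all `s, t ∈ [1/2, 1)`, `x, y ∈ ℝ³`. Proof:
module docstring, steps (a)–(d). This is the uniform regularity, up to the final time, of the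
rescaled sequence in the proof of Theorem 6.1 (Lemma 6.1 and "`|v(0,0)| = 1`"). [cite: KochNadirashviliSereginSverak2009, §4 (4.10)–(4.11) (p. 8) with Thm 6.1 and its proof (pp. 11–12), arXiv:0709.3599v1] -/
theorem KNSS2009_regularity_boundedWeak_window.lipschitz_of_cylRadius_bound
    (hW : KNSS2009_regularity_boundedWeak_window) (M : ℝ) :
    ∃ K : ℝ, 0 ≤ K ∧ ∀ (C : ℝ) ⦃u : ℝ → (EuclideanSpace ℝ (Fin 3)) → (EuclideanSpace ℝ (Fin 3))⦄,
      IsBoundedWeakNSSolutionOn (Ioo 0 1) isOpen_Ioo 1 u →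
      ContinuousOn (uncurry u) (Ioo (0 : ℝ) 1 ×ˢ univ) →
      (∀ t ∈ Ioo (0 : ℝ) 1, ∀ x, ‖u t x‖ ≤ M) →
      (∀ t ∈ Ioo (0 : ℝ) 1, ∀ x, cylRadius x * ‖u t x‖ ≤ C) →
      ∀ s ∈ Ico (1 / 2 : ℝ) 1, ∀ t ∈ Ico (1 / 2 : ℝ) 1, ∀ x y : (EuclideanSpace ℝ (Fin 3)),
        ‖u t x - u s y‖ ≤ K * (|t - s| + ‖x - y‖) := by
  obtain ⟨Cf, L, N, hmain⟩ := hW M 1 one_pos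
  set C₁ : ℝ := |Cf 1 (1 / 4)| with hC₁
  set L₀ : ℝ := |L 0 (1 / 4)| with hL₀
  set K : ℝ := C₁ + 2 * L₀ with hK
  have hC₁0 : 0 ≤ C₁ := abs_nonneg _
  have hL₀0 : 0 ≤ L₀ := abs_nonneg _
  refine ⟨K, by positivity, ?_⟩
  intro C u hu hcont hM hC
  obtain ⟨U, b, -, -, -, hae, hsmooth, -, hD, hL, -⟩ := hmain hu hM
  have hδ : (0 : ℝ) < 1 / 4 := by norm_num
  -- slices of `u` are continuous
  have hslice : ∀ t ∈ Ioo (0 : ℝ) 1, Continuous (u t) := fun t ht =>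
    hcont.comp_continuous (Continuous.prodMk_right t) fun x => ⟨ht, mem_univ x⟩
  -- (a) good times: `u t = U t + b t` everywhere
  set Gd : Set ℝ := {t | t ∈ Ioo (0 : ℝ) 1 → u t = fun x => U t x + b t} with hGd
  have hgood : ∀ᵐ t ∂(volume : Measure ℝ), t ∈ Gd := by
    have h1 := (ae_restrict_iff' (measurableSet_Ioo (a := (0 : ℝ)) (b := 1))).1 hae
    filter_upwards [h1] with t ht ht'
    have hcU : Continuous fun x => U t x + b t :=
      (hsmooth t ht').continuous.add continuous_const
    exact Measure.eq_of_ae_eq (ht ht') (hslice t ht') hcU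
  have hdense : Dense Gd := Measure.dense_of_ae hgood
  -- (b)–(c) the estimate at good times of `(1/4, 1)`
  have hest : ∀ s t : ℝ, s ∈ Ioo (1 / 4 : ℝ) 1 → t ∈ Ioo (1 / 4 : ℝ) 1 → s ∈ Gd → t ∈ Gd →
      ∀ x y : (EuclideanSpace ℝ (Fin 3)), ‖u t x - u s y‖ ≤ K * (|t - s| + ‖x - y‖) := by
    intro s t hs ht hsG htG x y
    have hs' : s ∈ Ioo (0 : ℝ) 1 := ⟨by linarith [hs.1], hs.2⟩
    have ht' : t ∈ Ioo (0 : ℝ) 1 := ⟨by linarith [ht.1], ht.2⟩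
    have hus : ∀ z, u s z = U s z + b s := fun z => congrFun (hsG hs') z
    have hut : ∀ z, u t z = U t z + b t := fun z => congrFun (htG ht') z
    -- time-Lipschitz bound for `U` at order zero
    have hUt : ∀ z, ‖U t z - U s z‖ ≤ L₀ * |t - s| := fun z => by
      have h := hL (1 / 4) hδ 0 s hs t ht z
      rw [norm_iteratedFDeriv_zero_sub] at h
      exact h.trans (mul_le_mul_of_nonneg_right (le_abs_self _) (abs_nonneg _))
    -- (b) the parasitic part: `‖b t - b s‖ ≤ L₀ |t - s|`, letting `|x'| → ∞`
    have hb : ‖b t - b s‖ ≤ L₀ * |t - s| := by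
      have hR : ∀ R : ℝ, 0 < R → ‖b t - b s‖ ≤ 2 * C / R + L₀ * |t - s| := by
        intro R hR
        set xR : (EuclideanSpace ℝ (Fin 3)) := EuclideanSpace.single 0 R with hxR
        have hrad : cylRadius xR = R := by rw [hxR, cylRadius_single_zero, abs_of_pos hR]
        have h1 : ‖u t xR‖ ≤ C / R := by
          rw [le_div_iff₀ hR, mul_comm]; simpa [hrad] using hC t ht' xR
        have h2 : ‖u s xR‖ ≤ C / R := by
          rw [le_div_iff₀ hR, mul_comm]; simpa [hrad] using hC s hs' xR
        have heq : b t - b s = (u t xR - u s xR) - (U t xR - U s xR) := by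
          rw [hut xR, hus xR]; abel
        calc ‖b t - b s‖ = ‖(u t xR - u s xR) - (U t xR - U s xR)‖ := by rw [heq]
          _ ≤ ‖u t xR‖ + ‖u s xR‖ + ‖U t xR - U s xR‖ :=
              (norm_sub_le _ _).trans (add_le_add (norm_sub_le _ _) le_rfl)
          _ ≤ C / R + C / R + L₀ * |t - s| := add_le_add (add_le_add h1 h2) (hUt xR)
          _ = 2 * C / R + L₀ * |t - s| := by ring
      have hlim : Tendsto (fun R : ℝ => 2 * C / R + L₀ * |t - s|) atTop
          (𝓝 (0 + L₀ * |t - s|)) :=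
        (tendsto_const_nhds.div_atTop tendsto_id).add tendsto_const_nhds
      rw [zero_add] at hlim
      exact ge_of_tendsto hlim ((eventually_gt_atTop 0).mono fun R hR0 => hR R hR0)
    -- (c) the smooth part in space: mean value inequality
    have hUx : ‖U t x - U t y‖ ≤ C₁ * ‖x - y‖ := by
      have hdiff : ∀ z ∈ (univ : Set (EuclideanSpace ℝ (Fin 3))), DifferentiableAt ℝ (U t) z := fun z _ =>
        ((hsmooth t ht').differentiable (by simp)) z
      have hbound : ∀ z ∈ (univ : Set (EuclideanSpace ℝ (Fin 3))), ‖fderiv ℝ (U t) z‖ ≤ C₁ := fun z _ => by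
        rw [← norm_iteratedFDeriv_one]
        exact (hD (1 / 4) hδ 1 t ht z).trans (le_abs_self _)
      exact Convex.norm_image_sub_le_of_norm_fderiv_le hdiff hbound convex_univ (mem_univ y)
        (mem_univ x)
    -- assemble
    have heq : u t x - u s y = (U t x - U t y) + (U t y - U s y) + (b t - b s) := by
      rw [hut x, hus y]; abel
    have hpos : 0 ≤ C₁ * |t - s| + 2 * L₀ * ‖x - y‖ := by positivity
    calc ‖u t x - u s y‖ = ‖(U t x - U t y) + (U t y - U s y) + (b t - b s)‖ := by rw [heq]
      _ ≤ ‖U t x - U t y‖ + ‖U t y - U s y‖ + ‖b t - b s‖ :=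
          (norm_add_le _ _).trans (add_le_add (norm_add_le _ _) le_rfl)
      _ ≤ C₁ * ‖x - y‖ + L₀ * |t - s| + L₀ * |t - s| := add_le_add (add_le_add hUx (hUt y)) hb
      _ ≤ K * (|t - s| + ‖x - y‖) := by rw [hK]; nlinarith
  -- (d) density of good times and continuity of `u`
  intro s hs t ht x y
  have hO : IsOpen (Ioo (1 / 4 : ℝ) 1) := isOpen_Ioo
  have hsub := hdense.open_subset_closure_inter hO
  have hsO : s ∈ Ioo (1 / 4 : ℝ) 1 := ⟨by linarith [hs.1], hs.2⟩
  have htO : t ∈ Ioo (1 / 4 : ℝ) 1 := ⟨by linarith [ht.1], ht.2⟩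
  obtain ⟨sq, hsq, hsql⟩ := mem_closure_iff_seq_limit.1 (hsub hsO)
  obtain ⟨tq, htq, htql⟩ := mem_closure_iff_seq_limit.1 (hsub htO)
  have hn : ∀ n, ‖u (tq n) x - u (sq n) y‖ ≤ K * (|tq n - sq n| + ‖x - y‖) := fun n =>
    hest (sq n) (tq n) (hsq n).1 (htq n).1 (hsq n).2 (htq n).2 x y
  -- continuity of `u` at `(t, x)` and `(s, y)`
  have hopen : IsOpen (Ioo (0 : ℝ) 1 ×ˢ (univ : Set (EuclideanSpace ℝ (Fin 3)))) := isOpen_Ioo.prod isOpen_univ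
  have hct : Tendsto (fun n => u (tq n) x) atTop (𝓝 (u t x)) := by
    have h1 : ContinuousAt (uncurry u) (t, x) :=
      hcont.continuousAt (hopen.mem_nhds ⟨⟨by linarith [ht.1], ht.2⟩, mem_univ x⟩)
    exact h1.tendsto.comp (htql.prodMk_nhds tendsto_const_nhds)
  have hcs : Tendsto (fun n => u (sq n) y) atTop (𝓝 (u s y)) := by
    have h1 : ContinuousAt (uncurry u) (s, y) :=
      hcont.continuousAt (hopen.mem_nhds ⟨⟨by linarith [hs.1], hs.2⟩, mem_univ y⟩)
    exact h1.tendsto.comp (hsql.prodMk_nhds tendsto_const_nhds)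
  refine le_of_tendsto_of_tendsto' (hct.sub hcs).norm ?_ hn
  exact (((continuous_abs.tendsto _).comp (htql.sub hsql)).add tendsto_const_nhds).const_mul K

end Literature.Analysis.FluidPDE

end
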